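import Literature.AlgebraicGeometry.Resolution.LogRegularScheme
import Literature.AlgebraicGeometry.Resolution.RegularLocalRingsNormal
import HarnessLib

/-!
# Logarithmically regular local rings are normal domains — Kato 1994, Theorem (4.1) (named fact)

Topic: `Literature/AlgebraicGeometry/Resolution`. K. Kato, *Toric singularities*, Amer. J. Math. 116
(1994), Theorem (4.1): "Let `(X, M)` be as in (S) and let `x ∈ X`. If `(X, M)` is regular at `x`, then
`𝒪_{X,x}` is Cohen–Macaulay and normal." Here (S) is Kato's standing hypothesis (1.5): `M` is a fine
saturated log structure on the Zariski site with charts, and "regular at `x`" is Definition (2.1)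
(`𝒪_{X,x}/I(x, M)` regular and `dim 𝒪_{X,x} = dim 𝒪_{X,x}/I(x,M) + rank_ℤ (M_x^{gp}/𝒪^×_{X,x})`).

## What is recorded

The statement for ONE fs chart through a Noetherian local ring, in the vocabulary of
`LogRegularScheme.lean`: for a Noetherian local ring `R`, a finitely generated submonoid `P ⊆ ℤⁿ`
saturated in `ℤⁿ` and spanning it, and a monoid homomorphism `φ : P → (R, ·)` (the chart of the
associated log structure `Pᵃ` on `Spec R`; `(Pᵃ)_x/𝒪^× = P/F` with `F = φ⁻¹(R^×)`, and
`I(x, Pᵃ) = φ(P ∖ F)·R`, so Kato's (2.1) at the closed point is `LogChart.IsLogRegularLocal P φ`), if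
`(R, φ)` is log regular then `R` is an integrally closed domain (`IsDomain R ∧ IsIntegrallyClosed R`).
The Cohen–Macaulay half of (4.1) is not recorded. Users take
`(h : Kato1994_logRegularLocal_isIntegrallyClosed)`; wanted by the route
`ResolutionOfSingularities/RadicialJung` (crux `CleanModelsSuffice`: it identifies the Kummer order
`⊕_{j<p} A·y^j/t^{⌊ja/p⌋}` — Kato log regular for the chart `A ⊗_{ℤ[ℕ^m]} ℤ[Q_a]` — with the local
rings of the normalisation of a log-clean regular model).

* `Kato1994_logRegularLocal_isIntegrallyClosed` — the named fact;
* `isDomain_and_isIntegrallyClosed_of_forall_isUnit` — PROVED consistency check in the case of a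
  chart by units (trivial log structure, Kato (2.2)(1)): then log regular = regular, and a regular
  local ring is a normal domain (Matsumura 14.3 / 19.4, in tree).

-- TODO(general form): Cohen–Macaulayness; log structures with several charts / on the étale site.

## Sources

* [Kato1994] K. Kato, *Toric singularities*, Amer. J. Math. 116 (1994) 1073–1099, Thm. (4.1) with
  (1.5), Def. (2.1), (2.2)(1).
-/

noncomputable section

namespace Literature.AlgebraicGeometry.Resolution

universe u

/-- NAMED FACT — **Kato 1994, Theorem (4.1): a logarithmically regular local ring is a normal
domain.** "If `(X, M)` is regular at `x`, then `𝒪_{X,x}` is Cohen–Macaulay and normal" — for the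
Zariski log structure associated to one fs chart `φ : P → (R, ·)` through the Noetherian local ring
`R = 𝒪_{X,x}` (`P ⊆ ℤⁿ` finitely generated, saturated, spanning; regularity in the sense of Kato
(2.1) = `LogChart.IsLogRegularLocal P φ`): `R` is an integrally closed domain. (Cohen–Macaulayness is
not recorded.) Users take `(h : Kato1994_logRegularLocal_isIntegrallyClosed)`.
[cite: Kato1994, Thm. (4.1)] -/
def Kato1994_logRegularLocal_isIntegrallyClosed : Prop :=
  ∀ (R : Type u) [CommRing R] [IsNoetherianRing R] [IsLocalRing R] (n : ℕ)
    (P : AddSubmonoid (Fin n → ℤ)) (φ : Multiplicative P →* R),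
    P.FG → P.NSMulSaturated → Submodule.span ℤ (P : Set (Fin n → ℤ)) = ⊤ →
    LogChart.IsLogRegularLocal P φ → IsDomain R ∧ IsIntegrallyClosed R

/-- **Consistency check (proved): charts by units.** If every chart element is a unit (the
associated log structure is trivial, Kato (2.2)(1)), log regularity of `(R, φ)` is regularity of `R`
(`LogChart.isLogRegularLocal_iff_of_forall_isUnit`), and a regular local ring is a normal domain
(Matsumura, Thm. 14.3 and Thm. 19.4, proved in tree) — the conclusion of
`Kato1994_logRegularLocal_isIntegrallyClosed` in this case, unconditionally. [cite: Kato1994, (2.2)(1)] -/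
theorem isDomain_and_isIntegrallyClosed_of_forall_isUnit (R : Type u) [CommRing R] {n : ℕ}
    (P : AddSubmonoid (Fin n → ℤ)) (hspan : Submodule.span ℤ (P : Set (Fin n → ℤ)) = ⊤)
    (φ : Multiplicative P →* R) (hunit : ∀ p : P, IsUnit (φ (Multiplicative.ofAdd p)))
    (h : LogChart.IsLogRegularLocal P φ) : IsDomain R ∧ IsIntegrallyClosed R := by
  haveI : IsRegularLocalRing R := (LogChart.isLogRegularLocal_iff_of_forall_isUnit P hspan φ hunit).1 h
  exact ⟨isDomain_of_isRegularLocalRing R, isIntegrallyClosed_of_isRegularLocalRing R⟩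

end Literature.AlgebraicGeometry.Resolution

end
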